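import Mathlib
import Summits.MatrixMultiplication.MatrixMultiplication.Theses.FidelityWitnesses
import Summits.MatrixMultiplication.MatrixMultiplication.Theorems.FidelityWitnessesFidelityThesisSepMajorantTransfer
import Summits.MatrixMultiplication.MatrixMultiplication.Theorems.FidelityThesis.Negative.SummitEquivalence
import Summits.MatrixMultiplication.MatrixMultiplication.Theorems.AsymptoticSpectrumMonotone
import Literature.Computability.AlgebraicComplexity.FlatteningBound

/-!
# Line `Sketch` (separable-majorant) for crux `FidelityWitnesses.FidelityThesis` (stmt-MatrixMultiplication-4956) —
# BUDGET SPLIT: the open stub `stub_fidelityGrowth` = crux item `DiagonalPowerDecay` (stmt-14053) + a small-budget law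

FIDELITY GROWTH FG(C, δ′): `F(S) ≤ C·r^{3/2−δ′}·N(S)` for all `n, r` and all `S` of rank `≤ r` in the `n × n` format
(`F = |⟨S,⟨n,n,n⟩⟩|²`, `N = ‖S‖²`).  The landed transfer `diagonalPowerDecay_of_fidelityGrowth` (p92236) reads FG at the
budget `r = n²` and gives the route's crux item `DiagonalPowerDecay` (stmt-MatrixMultiplication-14053).  This file proves the
converse ON THE LARGE-BUDGET REGIME `r ≥ n²` and packages the exact residual:

* `fgPad_exists` — ZERO-PADDING, definition-free: for `m ≤ n` and every `S` of the `m × m` format there is `S′` of the `n × n`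
  format with `R(S′) ≤ R(S)`, `⟨S′,⟨n,n,n⟩⟩ = ⟨S,⟨m,m,m⟩⟩`, `‖S′‖² = ‖S‖²` (extension by zero along `Fin.castLE × Fin.castLE`;
  `⟨m⟩` is the restriction of `⟨n⟩`, tree lemma `Literature.CplxAlg.matMulTensor_eq_comp_castLE`).
* `fidelityGrowth_largeBudget_of_dpd` — **DPD ⇒ FG on `{r ≥ n²}`**: pad `S` into the format `m = ⌊√r⌋ + 1 ≥ n` (rank
  `≤ r ≤ m²`), apply DPD there, and use `m ≤ 2√r`: `F ≤ 8C·r^{3/2−δ′}·N` with `δ′ = min δ ½`.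
* `stub_fidelityGrowth_iff_dpd_and_smallBudget` — **the registered open stub, verbatim, is EQUIVALENT to
  `DiagonalPowerDecay ∧ SmallBudgetGrowth`**, where SmallBudgetGrowth is FG restricted to `r < n²`
  (`∃ δ′ > 0, ∃ C > 0, ∀ n r S, r < n² → R(S) ≤ r → F ≤ C r^{3/2−δ′} N`): the line's only possible surplus over the
  existing crux item stmt-14053 is the SMALL-BUDGET regime ("few products in a big format"), where no padding is
  available; at `r ≪ n²` this is the localisation question `M(n,r) ≤ M(⌈√r⌉, r)·O(1)` (open), at `r → n²` it is DPD-like.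

So, kernel-checked: `stub_fidelityGrowth ⇒ DiagonalPowerDecay ⇒ FidelityThesis` (landed) and
`stub_fidelityGrowth ⇔ DiagonalPowerDecay ∧ SmallBudgetGrowth` (here) — nothing in crux stmt-4956 via this line can close
before stmt-14053 does.  Supports `stmt-MatrixMultiplication-4956` (lead a1); Mathlib + tree theorems only; no definitions.
-/

namespace Summit.MatrixMultiplication.MatrixMultiplication.Theorems

open scoped BigOperators
open Literature.Computability.AlgebraicComplexity
open Summit.MatrixMultiplication.MatrixMultiplication.Theses.FidelityWitnesses (DiagonalPowerDecay)

/-! ## Zero-padding `m × m ↪ n × n`, definition-free -/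

/-- **Zero-padding.** For `m ≤ n` and a tensor `S` of the `m × m` format there is a tensor `S′` of the `n × n` format
(extension of `S` by zero along `Fin.castLE × Fin.castLE` on every slot) with `R(S′) ≤ R(S)`,
`⟨S′,⟨n,n,n⟩⟩ = ⟨S,⟨m,m,m⟩⟩` and `‖S′‖² = ‖S‖²`. [folklore] -/
theorem fgPad_exists {m n : ℕ} (h : m ≤ n) (S : Fin m × Fin m → Fin m × Fin m → Fin m × Fin m → ℂ) :
    ∃ S' : Fin n × Fin n → Fin n × Fin n → Fin n × Fin n → ℂ,
      tensorRank S' ≤ tensorRank S ∧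
      (∑ a, ∑ b, ∑ c, S' a b c * matMulTensor ℂ n n n a b c) =
        (∑ a, ∑ b, ∑ c, S a b c * matMulTensor ℂ m m m a b c) ∧
      (∑ a, ∑ b, ∑ c, ‖S' a b c‖ ^ 2) = (∑ a, ∑ b, ∑ c, ‖S a b c‖ ^ 2) := by
  classical
  -- the embeddings
  let e : Fin m × Fin m → Fin n × Fin n := Prod.map (Fin.castLE h) (Fin.castLE h)
  have he : Function.Injective e := (Fin.castLE_injective h).prodMap (Fin.castLE_injective h)
  let e3 : (Fin m × Fin m) × (Fin m × Fin m) × (Fin m × Fin m) →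
      (Fin n × Fin n) × (Fin n × Fin n) × (Fin n × Fin n) := Prod.map e (Prod.map e e)
  have he3 : Function.Injective e3 := he.prodMap (he.prodMap he)
  -- padded vectors and the padded tensor
  let pv : (Fin m × Fin m → ℂ) → (Fin n × Fin n → ℂ) := fun w => Function.extend e w 0
  have pv_on : ∀ w a', pv w (e a') = w a' := fun w a' => he.extend_apply _ _ _
  have pv_off : ∀ w {a}, (¬ ∃ a', e a' = a) → pv w a = 0 := by
    intro w a ha
    show Function.extend e w 0 a = 0
    rw [Function.extend_apply' _ _ _ ha, Pi.zero_apply]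
  let S' : Fin n × Fin n → Fin n × Fin n → Fin n × Fin n → ℂ :=
    fun a b c => Function.extend e3 (fun x => S x.1 x.2.1 x.2.2) 0 (a, b, c)
  have S'_on : ∀ a' b' c', S' (e a') (e b') (e c') = S a' b' c' := fun a' b' c' =>
    he3.extend_apply (fun x => S x.1 x.2.1 x.2.2) 0 (a', b', c')
  -- sums of an extension by zero against anything: only the box contributes
  have sum_ext : ∀ (φ : (Fin n × Fin n) × (Fin n × Fin n) × (Fin n × Fin n) → ℂ → ℂ), (∀ y, φ y 0 = 0) →
      (∑ a, ∑ b, ∑ c, φ (a, b, c) (S' a b c)) = ∑ a', ∑ b', ∑ c', φ (e3 (a', b', c')) (S a' b' c') := by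
    intro φ hφ
    have l1 : (∑ a, ∑ b, ∑ c, φ (a, b, c) (S' a b c)) =
        ∑ y : (Fin n × Fin n) × (Fin n × Fin n) × (Fin n × Fin n), φ y (S' y.1 y.2.1 y.2.2) := by
      simp only [Fintype.sum_prod_type]
    have l2 : (∑ a', ∑ b', ∑ c', φ (e3 (a', b', c')) (S a' b' c')) =
        ∑ x : (Fin m × Fin m) × (Fin m × Fin m) × (Fin m × Fin m), φ (e3 x) (S x.1 x.2.1 x.2.2) := by
      simp only [Fintype.sum_prod_type]
    rw [l1, l2, ← Finset.sum_subset (Finset.subset_univ (Finset.univ.map ⟨e3, he3⟩)), Finset.sum_map]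
    · refine Finset.sum_congr rfl fun x _ => ?_
      show φ (e3 x) (Function.extend e3 (fun x => S x.1 x.2.1 x.2.2) 0 (e3 x)) = _
      rw [he3.extend_apply]
    · intro y _ hy
      have : S' y.1 y.2.1 y.2.2 = 0 := by
        show Function.extend e3 (fun x => S x.1 x.2.1 x.2.2) 0 y = 0
        rw [Function.extend_apply', Pi.zero_apply]
        rintro ⟨x, rfl⟩
        exact hy (Finset.mem_map.2 ⟨x, Finset.mem_univ _, rfl⟩)
      rw [this, hφ]
  refine ⟨S', ?_, ?_, ?_⟩
  · -- rank: pad a shortest decomposition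
    obtain ⟨w, u, v, hdec⟩ := exists_triad_decomposition_tensorRank S
    refine tensorRank_le_of_eq_sum (fun i => pv (w i)) (fun i => pv (u i)) (fun i => pv (v i)) ?_
    funext a b c
    rw [Finset.sum_apply, Finset.sum_apply, Finset.sum_apply]
    by_cases hx : ∃ x, e3 x = (a, b, c)
    · obtain ⟨⟨a', b', c'⟩, hx⟩ := hx
      simp only [e3, Prod.map, Prod.mk.injEq] at hx
      obtain ⟨rfl, rfl, rfl⟩ := hx
      have hpt : S a' b' c' = (∑ i, triad (w i) (u i) (v i)) a' b' c' := by rw [← hdec]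
      rw [S'_on, hpt, Finset.sum_apply, Finset.sum_apply, Finset.sum_apply]
      simp only [triad_apply, pv_on]
    · have h0 : S' a b c = 0 := by
        show Function.extend e3 (fun x => S x.1 x.2.1 x.2.2) 0 (a, b, c) = 0
        rw [Function.extend_apply' _ _ _ hx, Pi.zero_apply]
      rw [h0]
      symm
      refine Finset.sum_eq_zero fun i _ => ?_
      simp only [triad_apply]
      by_cases ha : ∃ a', e a' = a
      · by_cases hb : ∃ b', e b' = b
        · by_cases hc : ∃ c', e c' = c
          · obtain ⟨a', rfl⟩ := ha; obtain ⟨b', rfl⟩ := hb; obtain ⟨c', rfl⟩ := hc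
            exact absurd ⟨(a', b', c'), rfl⟩ hx
          · rw [pv_off _ hc, mul_zero]
        · rw [pv_off _ hb, mul_zero, zero_mul]
      · rw [pv_off _ ha, zero_mul, zero_mul]
  · -- overlap: `⟨n⟩` restricted to the box is `⟨m⟩`
    rw [sum_ext (fun y z => z * matMulTensor ℂ n n n y.1 y.2.1 y.2.2) (fun y => zero_mul _)]
    refine Finset.sum_congr rfl fun a' _ => Finset.sum_congr rfl fun b' _ => Finset.sum_congr rfl fun c' _ => ?_
    rw [Literature.CplxAlg.matMulTensor_eq_comp_castLE ℂ h]
    rfl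
  · -- norm
    have := sum_ext (fun _ z => ((‖z‖ ^ 2 : ℝ) : ℂ)) (fun _ => by simp)
    exact_mod_cast this

/-! ## DPD gives fidelity growth on the large-budget regime `r ≥ n²` -/

/-- `⌊√r⌋ + 1 ≤ 2√r` for `r ≥ 1`. [folklore] -/
theorem fgPad_sqrt_succ_le {r : ℕ} (hr : 1 ≤ r) : ((Nat.sqrt r + 1 : ℕ) : ℝ) ≤ 2 * Real.sqrt r := by
  have h1 : (Nat.sqrt r : ℝ) ≤ Real.sqrt r := by
    rw [Real.le_sqrt (Nat.cast_nonneg _) (Nat.cast_nonneg _)]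
    exact_mod_cast Nat.sqrt_le' r
  have h2 : (1 : ℝ) ≤ Real.sqrt r := by
    rw [Real.le_sqrt (by norm_num) (Nat.cast_nonneg _)]
    exact_mod_cast hr
  push_cast
  linarith

/-- **`DiagonalPowerDecay` ⇒ fidelity growth for all budgets `r ≥ n²`.**  From DPD at `(C, δ)`: with `δ′ = min δ ½ > 0`,
every `S` of rank `≤ r` in the `n × n` format with `n² ≤ r` has `F(S) ≤ 8C·r^{3/2−δ′}·N(S)` — zero-pad `S` into the format
`m = ⌊√r⌋ + 1` (`n ≤ m`, `r ≤ m²`, `fgPad_exists`), apply DPD in that format (`F ≤ C m^{3−2δ} N ≤ C m^{3−2δ′} N`, using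
`C ≥ 1` from the instance `⟨1,1,1⟩`), and bound `m^{3−2δ′} ≤ (2√r)^{3−2δ′} ≤ 8·r^{3/2−δ′}`. [folklore] -/
theorem fidelityGrowth_largeBudget_of_dpd (hD : DiagonalPowerDecay) :
    ∃ δ' : ℝ, 0 < δ' ∧ δ' ≤ 1 / 2 ∧ ∃ C : ℝ, 0 < C ∧
      ∀ (n r : ℕ) (S : Fin n × Fin n → Fin n × Fin n → Fin n × Fin n → ℂ), n ^ 2 ≤ r → tensorRank S ≤ r →
        ‖∑ a, ∑ b, ∑ c, S a b c * matMulTensor ℂ n n n a b c‖ ^ 2 ≤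
          C * (r : ℝ) ^ (3 / 2 - δ') * ∑ a, ∑ b, ∑ c, ‖S a b c‖ ^ 2 := by
  obtain ⟨C, δ, hδ, hB⟩ := hD
  -- `C ≥ 1` from the instance `n = 1`, `S = ⟨1,1,1⟩`
  have hC1 : 1 ≤ C := by
    have h1 := hB 1 (matMulTensor ℂ 1 1 1) ((tensorRank_matMulTensor_le ℂ 1 1 1).trans (by norm_num))
    rw [fidelityThesis_overlap_self, fidelityThesis_normSq_matMulTensor, norm_pow, Complex.norm_natCast] at h1
    simpa using h1
  set δ' : ℝ := min δ (1 / 2) with hδ'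
  have hδ'0 : 0 < δ' := lt_min hδ (by norm_num)
  have hδ'h : δ' ≤ 1 / 2 := min_le_right _ _
  have hδ'δ : δ' ≤ δ := min_le_left _ _
  refine ⟨δ', hδ'0, hδ'h, 8 * C, by linarith, fun n r S hnr hS => ?_⟩
  set F := ‖∑ a, ∑ b, ∑ c, S a b c * matMulTensor ℂ n n n a b c‖ ^ 2 with hF
  set N := ∑ a, ∑ b, ∑ c, ‖S a b c‖ ^ 2 with hN
  have hN0 : 0 ≤ N := by positivity
  rcases Nat.eq_zero_or_pos r with hr0 | hr1
  · -- `r = 0`: then `n = 0` and all sums are empty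
    subst hr0
    have hn : n = 0 := (pow_eq_zero_iff (by norm_num : (2 : ℕ) ≠ 0)).1 (Nat.le_zero.1 hnr)
    subst hn
    simp [hF, hN]
  -- the auxiliary format `m = ⌊√r⌋ + 1`
  set m : ℕ := Nat.sqrt r + 1 with hm
  have hrm : r ≤ m ^ 2 := by
    have := Nat.lt_succ_sqrt' r
    rw [hm]; nlinarith
  have hnm : n ≤ m := by
    by_contra hlt
    rw [not_le] at hlt
    have : m ^ 2 < n ^ 2 := Nat.pow_lt_pow_left hlt (by norm_num)
    omega
  obtain ⟨S', hrank, hov, hnorm⟩ := fgPad_exists hnm S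
  have key := hB m S' ((hrank.trans hS).trans hrm)
  rw [hov, hnorm] at key
  -- `key : F ≤ C * m^{3-2δ} * N`; replace the exponent by `3 - 2δ'` (`m ≥ 1`, `C ≥ 0`)
  have hm1 : (1 : ℝ) ≤ m := by rw [hm]; exact_mod_cast Nat.le_add_left 1 _
  have hm0 : (0 : ℝ) ≤ m := by linarith
  have hexp : (m : ℝ) ^ (3 - 2 * δ) ≤ (m : ℝ) ^ (3 - 2 * δ') :=
    Real.rpow_le_rpow_of_exponent_le hm1 (by linarith)
  have hC0 : 0 ≤ C := by linarith
  have key' : F ≤ C * (m : ℝ) ^ (3 - 2 * δ') * N :=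
    key.trans (mul_le_mul_of_nonneg_right (mul_le_mul_of_nonneg_left hexp hC0) hN0)
  -- `m^{3-2δ'} ≤ (2√r)^{3-2δ'} = 2^{3-2δ'} r^{3/2-δ'} ≤ 8 r^{3/2-δ'}`
  have hr0' : (0 : ℝ) ≤ r := Nat.cast_nonneg r
  have hsq : (m : ℝ) ≤ 2 * Real.sqrt r := by rw [hm]; exact fgPad_sqrt_succ_le hr1
  have he0 : 0 ≤ 3 - 2 * δ' := by linarith
  have h1 : (m : ℝ) ^ (3 - 2 * δ') ≤ (2 * Real.sqrt r) ^ (3 - 2 * δ') := Real.rpow_le_rpow hm0 hsq he0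
  have h2 : (2 * Real.sqrt r) ^ (3 - 2 * δ') = (2 : ℝ) ^ (3 - 2 * δ') * (r : ℝ) ^ (3 / 2 - δ') := by
    rw [Real.mul_rpow (by norm_num) (Real.sqrt_nonneg _), Real.sqrt_eq_rpow, ← Real.rpow_mul hr0']
    congr 1; ring_nf
  have h3 : (2 : ℝ) ^ (3 - 2 * δ') ≤ 8 := by
    calc (2 : ℝ) ^ (3 - 2 * δ') ≤ (2 : ℝ) ^ (3 : ℝ) := Real.rpow_le_rpow_of_exponent_le (by norm_num) (by linarith)
      _ = 8 := by norm_num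
  have hrpow0 : 0 ≤ (r : ℝ) ^ (3 / 2 - δ') := Real.rpow_nonneg hr0' _
  have h4 : (m : ℝ) ^ (3 - 2 * δ') ≤ 8 * (r : ℝ) ^ (3 / 2 - δ') := by
    rw [h2] at h1
    exact h1.trans (mul_le_mul_of_nonneg_right h3 hrpow0)
  calc F ≤ C * (m : ℝ) ^ (3 - 2 * δ') * N := key'
    _ ≤ C * (8 * (r : ℝ) ^ (3 / 2 - δ')) * N :=
        mul_le_mul_of_nonneg_right (mul_le_mul_of_nonneg_left h4 hC0) hN0
    _ = 8 * C * (r : ℝ) ^ (3 / 2 - δ') * N := by ring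

/-! ## The registered open stub ⟺ DiagonalPowerDecay ∧ small-budget growth -/

/-- `r^{3/2−δ₂} ≤ r^{3/2−δ₁}` for naturals `r` whenever `δ₁ ≤ δ₂ < 3/2` (both sides read in `ℝ`; `r = 0` gives `0 ≤ 0`).
[folklore] -/
theorem fgPad_rpow_budget_mono {δ₁ δ₂ : ℝ} (h12 : δ₁ ≤ δ₂) (h2 : δ₂ < 3 / 2) (r : ℕ) :
    (r : ℝ) ^ (3 / 2 - δ₂) ≤ (r : ℝ) ^ (3 / 2 - δ₁) := by
  rcases Nat.eq_zero_or_pos r with rfl | hr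
  · rw [Nat.cast_zero, Real.zero_rpow (by linarith), Real.zero_rpow (by linarith)]
  · exact Real.rpow_le_rpow_of_exponent_le (by exact_mod_cast hr) (by linarith)

/-- **Budget split of the open stub.** `stub_fidelityGrowth` (verbatim, left) is EQUIVALENT to the conjunction of the route's
crux item `DiagonalPowerDecay` (stmt-MatrixMultiplication-14053) and SMALL-BUDGET GROWTH — fidelity growth restricted to
`r < n²`.  (⇒: `diagonalPowerDecay_of_fidelityGrowth` and restriction; ⇐: `fidelityGrowth_largeBudget_of_dpd` on `r ≥ n²`,
the small-budget law on `r < n²`, with `δ′ = min` and `C = max` of the two.) [folklore] -/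
theorem stub_fidelityGrowth_iff_dpd_and_smallBudget :
    (∃ δ' : ℝ, 0 < δ' ∧ δ' < 3 / 2 ∧ ∃ C : ℝ, 0 < C ∧
      ∀ (n r : ℕ) (S : Fin n × Fin n → Fin n × Fin n → Fin n × Fin n → ℂ), tensorRank S ≤ r →
        ‖∑ a, ∑ b, ∑ c, S a b c * matMulTensor ℂ n n n a b c‖ ^ 2 ≤
          C * (r : ℝ) ^ (3 / 2 - δ') * ∑ a, ∑ b, ∑ c, ‖S a b c‖ ^ 2) ↔
    (DiagonalPowerDecay ∧
      ∃ δ' : ℝ, 0 < δ' ∧ δ' < 3 / 2 ∧ ∃ C : ℝ, 0 < C ∧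
        ∀ (n r : ℕ) (S : Fin n × Fin n → Fin n × Fin n → Fin n × Fin n → ℂ), r < n ^ 2 → tensorRank S ≤ r →
          ‖∑ a, ∑ b, ∑ c, S a b c * matMulTensor ℂ n n n a b c‖ ^ 2 ≤
            C * (r : ℝ) ^ (3 / 2 - δ') * ∑ a, ∑ b, ∑ c, ‖S a b c‖ ^ 2) := by
  constructor
  · intro hFG
    refine ⟨diagonalPowerDecay_of_fidelityGrowth hFG, ?_⟩
    obtain ⟨δ', h0, h1, C, hC, h⟩ := hFG
    exact ⟨δ', h0, h1, C, hC, fun n r S _ hS => h n r S hS⟩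
  · rintro ⟨hD, δ₂, h20, h21, C₂, hC₂, hsmall⟩
    obtain ⟨δ₁, h10, h11, C₁, hC₁, hlarge⟩ := fidelityGrowth_largeBudget_of_dpd hD
    refine ⟨min δ₁ δ₂, lt_min h10 h20, (min_le_left _ _).trans_lt (by linarith), max C₁ C₂,
      lt_max_of_lt_left hC₁, fun n r S hS => ?_⟩
    have hN0 : 0 ≤ ∑ a, ∑ b, ∑ c, ‖S a b c‖ ^ 2 := by positivity
    have hr0 : 0 ≤ (r : ℝ) ^ (3 / 2 - min δ₁ δ₂) := Real.rpow_nonneg (Nat.cast_nonneg r) _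
    rcases Nat.lt_or_ge r (n ^ 2) with hr | hr
    · calc _ ≤ C₂ * (r : ℝ) ^ (3 / 2 - δ₂) * ∑ a, ∑ b, ∑ c, ‖S a b c‖ ^ 2 := hsmall n r S hr hS
        _ ≤ max C₁ C₂ * (r : ℝ) ^ (3 / 2 - min δ₁ δ₂) * ∑ a, ∑ b, ∑ c, ‖S a b c‖ ^ 2 :=
          mul_le_mul_of_nonneg_right (mul_le_mul (le_max_right _ _)
            (fgPad_rpow_budget_mono (min_le_right _ _) h21 r) (Real.rpow_nonneg (Nat.cast_nonneg r) _)
            (le_trans hC₁.le (le_max_left _ _))) hN0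
    · calc _ ≤ C₁ * (r : ℝ) ^ (3 / 2 - δ₁) * ∑ a, ∑ b, ∑ c, ‖S a b c‖ ^ 2 := hlarge n r S hr hS
        _ ≤ max C₁ C₂ * (r : ℝ) ^ (3 / 2 - min δ₁ δ₂) * ∑ a, ∑ b, ∑ c, ‖S a b c‖ ^ 2 :=
          mul_le_mul_of_nonneg_right (mul_le_mul (le_max_left _ _)
            (fgPad_rpow_budget_mono (min_le_left _ _) (by linarith) r) (Real.rpow_nonneg (Nat.cast_nonneg r) _)
            (le_trans hC₁.le (le_max_left _ _))) hN0

end Summit.MatrixMultiplication.MatrixMultiplication.Theorems
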